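import Literature.AnabelianGeometry.EtaleTheta.Discharge.Sec5Thm57FinalKnitV6
import Literature.AnabelianGeometry.EtaleTheta.Discharge.Sec5RootDivisorInvarianceOfKernel
import Literature.AnabelianGeometry.EtaleTheta.LogDivisorModelTateTowerArithmeticProp32iiiMLF

/-!
# [EtTh] §5, Theorem 5.7 at the genuine connected tower — FINAL KNIT v6 (root side, GENERIC `(X, 𝒯, ιX)`) with the (C) clause
# «⋂_N (K^×)^N = 1» (Prop. 3.2 (iii)) at an MLF constant field AND the §5 input `hinvp` DISCHARGED BY NAME (pp. 296, 317, 322, 329–331)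

Mochizuki, *The étale theta function and its Frobenioid-theoretic manifestations*, Publ. RIMS **45** (2009)
[cite: MochizukiEtTh2009, Thm 5.7 p.329–330 (PDF pp.103–104); Prop 3.2 (iii) p.296 (PDF p.70); Prop 4.3 (i) p.317 (PDF p.91); §5 p.322
(PDF p.96) «K a finite extension of ℚ_p»; Lem 5.8 p.331 (PDF p.105); Prop 4.2 (iv) p.315–316 (PDF pp.89–90)].  abc-iut cell, layer L2, node
`EtTh:Thm5.7`; abc-iut-L2-lead R923 «HINVP-BY-NAME AT THE JUNCTION», file A′ of «THM57-V6-HK-MLF KNIT» (seat abc-iut-f-123 gen 7; A = p484296,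
B = p486421).  PROOF-ONLY (0 definitions, 0 instances, 0 notation, 0 new named facts; nothing landed is edited or restated).

THE POINT.  Of the v6 decls of record only the GENERIC root side — abc-iut-f-123's `…_final_v6` (p476561) at ANY
`(X, 𝒯 : ThetaEnvTower E, ιX : 𝒯.PiX ≃ₜ* X.Pi)` over abc-iut-L2-t4's §5 choice `A_⊙^bs := Ÿ` (`mkOfConnectedTemperoidYddTower`) — still
displayed the §5 data's divisor-invariance input `hinvp` («`Φ(ρ_{A_N}(ιX y))` fixes `Div(s^⊔_N)` for `y ∈ Π^tp_Ÿ`») outside the Setting.  It is an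
INPUT OF THE TOWER CONSTRUCTOR `ofConnectedTemperoidFamily … hinvc hinvp α β …` (inside `hT`), and abc-iut-L2-t3's
`hinvp_family_ofConnectedTemperoidYddTower h R` (p483063; print's Prop. 4.3 (i) route from the kernel `H_⊙` alone, no divisor hypothesis) is
GENERIC there too.  RESULT `thetaRootPreservedAll_ofConnectedTemperoidYddFamily_final_v6_of_mlf_of_kernel`: p476561 with `hinvp :=` that
theorem substituted into the constructor, and the (C) clause `hK` := `MLFDivisible.units_eq_one_of_forall_exists_pow_eq p K'` (p480502) under
`(p : ℕ) [Fact p.Prime] [Algebra ℚ_[p] K'] [FiniteDimensional ℚ_[p] K']` (`T.K` IS `K'` along `hT`; assumed in the signature, never declared).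
Every other binder VERBATIM p476561 (displayed (C) = `htorsfam`; its module docstring has the census).  The Setting decls of record are
hinvp-free in `Sec5Thm57FinalKnitV6OfMLFSetting.lean` (p486421).  HONEST FRAMING: kernel-checked substitution into a landed theorem for data so
parametrised (no `TemperedFrobenioid` of an actual curve is constructed in the tree); nothing of [EtTh] beyond Prop. 3.2 (iii) / the `hinvp`
implication is asserted unconditionally; typed ≠ discharged — PROVED modulo the displayed binders; no side taken on anything downstream
([IUTchIII] Cor. 3.12 in particular).
-/

noncomputable section

namespace Literature.AnabelianGeometry.EtaleTheta

open CategoryTheory Opposite Literature.AlgebraicGeometry.Frobenioids Literature.AnabelianGeometry.SemiGraphs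
  Literature.AnabelianGeometry.SemiGraphs.GaloisObjects

universe v₀ u₁ v₁

namespace ThetaFrobenioidTower

section DictionaryV6MLFK

variable {K : Type} [Field K] {X : SemiGraphs.TemperedArithmeticGroup.{0} K} {D₀ : Type} [Category.{v₀} D₀]
  {V : FrdIMonoidStub.{0}} {T₀ : RealifiedDivisorMonoids (D₀ := D₀) V}
  {VD : FrdICatStub.{1, 0, 0} (ConnectedPart (BTemp X.Pi))}
  {tf : TemperedFrobenioid T₀ (ConnectedPart (BTemp X.Pi)) VD} {hZ : tf.monoidType = MonoidType.Z}
  {hP : ∀ A : (ConnectedPart (BTemp X.Pi))ᵒᵖ, IsPerfect (tf.Φ.carrier A)}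
  {NH : Subgroup (Field.absoluteGaloisGroup K) → tf.category → ℕ+ → Prop}
  {E : Set ℕ+} (𝒯 : ThetaEnvTower.{0} E) (ιX : 𝒯.PiX ≃ₜ* X.Pi)
  {pullFrac : ∀ {A A' : (BiKummerSetting.mkOfConnectedTemperoidYddTower X tf hZ hP NH 𝒯 ιX).C} (_ : A' ⟶ A),
    (BiKummerSetting.mkOfConnectedTemperoidYddTower X tf hZ hP NH 𝒯 ιX).biratUnits A →
      (BiKummerSetting.mkOfConnectedTemperoidYddTower X tf hZ hP NH 𝒯 ιX).biratUnits A'}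
  {lv : ℕ+}
  {θ : (BiKummerSetting.mkOfConnectedTemperoidYddTower X tf hZ hP NH 𝒯 ιX).biratUnits
    (BiKummerSetting.mkOfConnectedTemperoidYddTower X tf hZ hP NH 𝒯 ιX).Aodot}
  {Bl : (BiKummerSetting.mkOfConnectedTemperoidYddTower X tf hZ hP NH 𝒯 ιX).C}
  {Pl : (BiKummerSetting.mkOfConnectedTemperoidYddTower X tf hZ hP NH 𝒯 ιX).FractionPair θ Bl}
  {Rl : (BiKummerSetting.mkOfConnectedTemperoidYddTower X tf hZ hP NH 𝒯 ιX).NthRoot θ Pl lv pullFrac}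
  (h : ModelFrobenioid.Hypotheses tf.divisorMonoid tf.ratFnFunctor)
  (Q : FrobenioidTheta.ThetaSubquotientStub.{0} (ConnectedPart (BTemp X.Pi))) (odd_l : Odd (lv : ℕ))
  (R : ∀ N : ℕ+, (BiKummerSetting.mkOfConnectedTemperoidYddTower X tf hZ hP NH 𝒯 ιX).NthRoot Rl.root Rl.pair N pullFrac)
  (K' : Type) [Field K'] {X₀ : ConnectedPart (BTemp X.Pi)}
  (hX₀ : ∀ Y : ConnectedPart (BTemp X.Pi), Subsingleton (Y ⟶ X₀)) (t : ∀ N : ℕ+, (R N).BN.base ⟶ X₀)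
  (c₀ : K'ˣ →* (tf.ratFnFunctor.obj (op X₀))ˣ)
  (hc₀ : Function.Injective c₀) (ht : ∀ N : ℕ+, Function.Injective (tf.ratFnFunctor.map (t N).op).hom)
  (hinvc : ∀ (N : ℕ+) (g : Aut (R N).AN.base),
    pull tf.divisorMonoid g.hom (ModelFrobenioid.div (R N).pair.num) = ModelFrobenioid.div (R N).pair.num)
  (α : ∀ {N N' : ℕ+}, (N : ℕ) ∣ N' → ((R N').AN ⟶ (R N).AN))
  (β : ∀ {N N' : ℕ+}, (N : ℕ) ∣ N' → ((R N').BN ⟶ (R N).BN))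
  (comm_sCap : ∀ {N N' : ℕ+} (hd : (N : ℕ) ∣ N'), (R N').pair.num ≫ β hd = α hd ≫ (R N).pair.num)
  (comm_sCup : ∀ {N N' : ℕ+} (hd : (N : ℕ) ∣ N'), (R N').pair.den ≫ β hd = α hd ≫ (R N).pair.den)
  (isIsometry_α : ∀ {N N' : ℕ+} (hd : (N : ℕ) ∣ N'),
    ((BiKummerSetting.mkOfConnectedTemperoidYddTower X tf hZ hP NH 𝒯 ιX).sec5Stub h).pre.IsIsometry (α hd))
  (degFr_α : ∀ {N N' : ℕ+} (hd : (N : ℕ) ∣ N'),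
    (((BiKummerSetting.mkOfConnectedTemperoidYddTower X tf hZ hP NH 𝒯 ιX).sec5Stub h).pre.degFr (α hd) : ℕ) * N = N')
  (isIsometry_β : ∀ {N N' : ℕ+} (hd : (N : ℕ) ∣ N'),
    ((BiKummerSetting.mkOfConnectedTemperoidYddTower X tf hZ hP NH 𝒯 ιX).sec5Stub h).pre.IsIsometry (β hd))
  (degFr_β : ∀ {N N' : ℕ+} (hd : (N : ℕ) ∣ N'),
    (((BiKummerSetting.mkOfConnectedTemperoidYddTower X tf hZ hP NH 𝒯 ιX).sec5Stub h).pre.degFr (β hd) : ℕ) * N = N')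
  (baseFrob_α : ∀ {N N' : ℕ+} (hd : (N : ℕ) ∣ N'),
    (BiKummerSetting.mkOfConnectedTemperoidYddTower X tf hZ hP NH 𝒯 ιX).IsOfBaseFrobeniusType (α hd))
  (h44 : BiKummerSetting.Thm44Hyp (BiKummerSetting.mkOfConnectedTemperoidYddTower X tf hZ hP NH 𝒯 ιX)
    (BiKummerSetting.mkOfConnectedTemperoidYddTower X tf hZ hP NH 𝒯 ιX))
  (ψ : ∀ A : (BiKummerSetting.mkOfConnectedTemperoidYddTower X tf hZ hP NH 𝒯 ιX).C,
    (BiKummerSetting.mkOfConnectedTemperoidYddTower X tf hZ hP NH 𝒯 ιX).biratUnits A ≃*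
      (BiKummerSetting.mkOfConnectedTemperoidYddTower X tf hZ hP NH 𝒯 ιX).biratUnits (h44.Ψ.functor.obj A))
  (hpull : ∀ {A A' : (BiKummerSetting.mkOfConnectedTemperoidYddTower X tf hZ hP NH 𝒯 ιX).C} (φ : A' ⟶ A)
    (f : (BiKummerSetting.mkOfConnectedTemperoidYddTower X tf hZ hP NH 𝒯 ιX).biratUnits A),
      ψ A' (pullFrac φ f) = pullFrac (h44.Ψ.functor.map φ) (ψ A f))
  (hii : BiKummerSetting.Thm44_ii h44 ψ) (h3 : h44.PreservesFrobeniusStructure) (h4b : h44.PreservesBaseFrobeniusTypeData)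
  (h8 : h44.PreservesAmple) (h15a : h44.PreservesFixedByHA ψ) (h15 : h44.PreservesSaturated ψ)
  -- (B1)/(B1′): the Def. 4.1 (iv) datum of each transition `α_{1,N}` and its pull-back compatibility
  (D : ∀ N : ℕ+, (BiKummerSetting.mkOfConnectedTemperoidYddTower X tf hZ hP NH 𝒯 ιX).BaseFrobeniusTypeData (α (one_dvd_level N)))

include hX₀ h hc₀ ht comm_sCap comm_sCup isIsometry_α degFr_α isIsometry_β degFr_β hpull hii h3 h4b h8 h15a h15 D in
/-- **[EtTh] Theorem 5.7 at the genuine connected tower — FINAL KNIT v6 (root side), generic `(X, 𝒯, ιX)`, constant field an MLF, `hinvp`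
from the kernel `H_⊙`**: abc-iut-f-123's `thetaRootPreservedAll_ofConnectedTemperoidYddFamily_final_v6` (p476561) with `hK` :=
`MLFDivisible.units_eq_one_of_forall_exists_pow_eq p K'` (p480502) and `hinvp := hinvp_family_ofConnectedTemperoidYddTower h R` (p483063)
inside the tower of `hT`; every other binder VERBATIM p476561.
[cite: MochizukiEtTh2009, Thm 5.7 p.329–330 (PDF pp.103–104); Prop 3.2 (iii) p.296 (PDF p.70); Prop 4.3 (i) p.317 (PDF p.91); Lem 5.8 p.331 (PDF p.105)] -/
theorem thetaRootPreservedAll_ofConnectedTemperoidYddFamily_final_v6_of_mlf_of_kernel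
    (T : ThetaFrobenioidTower.{0} (BiKummerSetting.mkOfConnectedTemperoidYddTower X tf hZ hP NH 𝒯 ιX).C
      (ConnectedPart (BTemp X.Pi)))
    (hT : T = ofConnectedTemperoidFamily h Q odd_l R ιX K' (fun N => (Units.map (tf.ratFnFunctor.map (t N).op).hom).comp c₀)
      (fun N => tf.unitsMap_comp_injective (t N) hc₀ (ht N)) hinvc (hinvp_family_ofConnectedTemperoidYddTower h R)
      α β comm_sCap comm_sCup isIsometry_α degFr_α
      isIsometry_β degFr_β baseFrob_α)
    (hnd : IsNonDilatingOn tf.divisorMonoid)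
    -- (A) Lemma 5.8's geometric connectedness at EVERY level `N`: «a unit of `B_N` commuting with `s^⊓-gp_N(Im Π^tp_Y̲)` is a constant»
    -- (displayed; its level-1 instance is what v1–v5 discharged from the ONE `ConstantsDictionary` junction binder)
    (hgc : ∀ (N : ℕ+) (u : (T.atLevel N).units (T.BN N)),
      (∀ y ∈ (T.atLevel N).imPiY, T.sgpCap N y * (u : Aut (T.BN N)) * (T.sgpCap N y)⁻¹ = u) →
        (T.atLevel N).unitsToBirat (T.BN N) u ∈ (T.constEmb N).range)
    -- (A) `hfac₁` RE-KEYED (abc-iut-w5-d123 p447915): Prop. 3.4 (ii), the identification `D → D₀ → D^cnst ≅ aug_* ⋙ G`, and `hYdd`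
    {Dcnst : Type u₁} [Category.{v₁} Dcnst] (cnst : D₀ ⥤ Dcnst) (G : ConnectedPart (BTemp (Field.absoluteGaloisGroup K)) ⥤ Dcnst)
    (ecn : tf.base ⋙ cnst ≅ QuasiTemperoid.pushforward X.aug.toMonoidHom X.aug_surjective X.augIsOpenMap_holds ⋙ G)
    (hP34 : RealifiedDivisorMonoids.Prop34Cnst T₀ cnst)
    (hYdd : ∀ y : 𝒯.PiX, ∃ k ∈ 𝒯.PiYdd, X.aug (ιX k) = X.aug (ιX y))
    -- the rendering law of `pullFrac` (the model's `((·)^birat)^*`), the transitions over the base pair, and the Prop. 2.4-class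
    -- clause at the chosen first root ("`S₂^bs` characteristic", p.329): these DISCHARGE `hpull₂`, `hD`, `hf`, `hΨFT`, `hbs` of `…_final`
    (hF : ∀ {B B' : (BiKummerSetting.mkOfConnectedTemperoidYddTower X tf hZ hP NH 𝒯 ιX).C} (φ : B' ⟶ B)
      (y : (BiKummerSetting.mkOfConnectedTemperoidYddTower X tf hZ hP NH 𝒯 ιX).biratUnits B), pullFrac φ y = tf.pullFracModel φ y)
    (hαover : ∀ N : ℕ+, α (one_dvd_level N) ≫ (R 1).α = (R N).α)
    -- «`A_N^bs` characteristic» at EVERY level (the [EtTh] Prop. 2.4-class clause; its `N = 1` instance is v2's `hcharN`; it yields v2's `hebs`)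
    (hcharAN : ∀ N : ℕ+, IsTopCharacteristic X.Pi (galoisSurjOf X.isTempered (R N).AN.base.obj (R N).αData.isGalois).ker)
    (hdivA : ∀ αA : h44.Ψ.functor.obj (T.AN 1) ≅ T.AN 1, ∃ ε : Aut (T.AN 1),
      T.pre.div (αA.inv ≫ h44.Ψ.functor.map (T.sCap 1)) = T.pre.div (ε.hom ≫ T.sCap 1) ∧
      T.pre.div (αA.inv ≫ h44.Ψ.functor.map (T.sCup 1)) = T.pre.div (ε.hom ≫ T.sCup 1))
    (hP24 : ∀ γ : 𝒯.PiX ≃ₜ* 𝒯.PiX, 𝒯.PiYdd.map γ.toMulEquiv.toMonoidHom = 𝒯.PiYdd)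
    -- [EtTh] LEMMA 5.8 FOR CONSTANTS, print verbatim: «(K^×)^{1/N} ⊆ O^×(B_N^birat)» — every constant `c ∈ K'^×` read on `B_N^bs` (along
    -- `t N`) has an `N`-th root in `B(B_N^bs)^×` (p.331 (PDF p.105)); it feeds the root clause at the PRODUCED anchor, whose discrepancy
    -- unit is a constant (the fixedness half, Def 3.6 (iii), is then a theorem — abc-iut-f-123 p455663)
    (h58N : ∀ (N : ℕ+) (c : K'ˣ), ∃ r : tf.biratUnitsModel (R N).BN,
      (r : tf.ratFnFunctor.obj (op (R N).BN.base)) ^ (N : ℕ) = (tf.ratFnFunctor.map (t N).op).hom (c₀ c : tf.ratFnFunctor.obj (op X₀)))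
    -- [EtTh] Prop 4.2 (iv) L05 input OVER THE DOMAIN `A_1` of the twisted level-1 pair: the roots-of-constants law (abc-iut-w4-d044's
    -- `hL`, G-w4d044-1's shape at `A := A_1`; [FrdII] Rmk 2.2.1) — consumed ONLY by `Prop42Sub.unitRootsUpstairsAt_of_constantRootsAt`
    (hL : ∀ (A'' : (BiKummerSetting.mkOfConnectedTemperoidYddTower X tf hZ hP NH 𝒯 ιX).C) (N : ℕ+)
      (g : A''.base ⟶ (R 1).AN.base) (ξ : tf.ratFnFunctor.obj (op (R 1).AN.base)),
      (BiKummerSetting.mkOfConnectedTemperoidYddTower X tf hZ hP NH 𝒯 ιX).IsFrobeniusTrivial A'' →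
      (BiKummerSetting.mkOfConnectedTemperoidYddTower X tf hZ hP NH 𝒯 ιX).IsNHSaturatedBsFld
        (BiKummerSetting.mkOfConnectedTemperoidYddTower X tf hZ hP NH 𝒯 ιX).HodotBsFld A'' N →
      divB tf.divisorMonoid tf.ratFnFunctor tf.divBNatTrans (op (R 1).AN.base) ξ = 1 →
        ∃ ζ : tf.ratFnFunctor.obj (op A''.base), ζ ^ (N : ℕ) = pull tf.ratFnFunctor g ξ)
    -- (C) in TORSION shape (abc-iut-w6-d049 p473372): `⋂_N (K^×)^N = 1` (Prop 3.2 (iii)) and, at every level of the tower's cofinal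
    -- index set `E` and for every family member `(a, b, w)` coherent with the CONSTANT normalised anchor, the Kummer cocycle of `w^{2l}`
    -- along `H_{B_N}` is that of a torsion unit (Cor 2.8 (i) on Prop 5.2 (iii)'s classes via Thm 5.6 — the étale half instantiates it)
    -- (C) Prop. 3.2 (iii) `⋂_N (K'^×)^N = 1` is NO LONGER A BINDER: `K'` is a finite extension of `ℚ_p` (print p.322), and
    -- the clause is abc-iut-f-123's theorem `MLFDivisible.units_eq_one_of_forall_exists_pow_eq` (p480502)
    (p : ℕ) [Fact p.Prime] [Algebra ℚ_[p] K'] [FiniteDimensional ℚ_[p] K']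
    (htorsfam : ∀ (α₁ : h44.Ψ.functor.obj (T.AN 1) ≅ T.AN 1) (β₁ : h44.Ψ.functor.obj (T.BN 1) ≅ T.BN 1) (u₁ : Aut (T.BN 1))
      (hu₁ : u₁ ∈ (T.atLevel 1).units (T.BN 1)),
      α₁.inv ≫ h44.Ψ.functor.map (T.sCap 1) ≫ β₁.hom = T.sCap 1 →
      α₁.inv ≫ h44.Ψ.functor.map (T.sCup 1) ≫ β₁.hom = T.sCup 1 ≫ u₁.hom →
      ∀ c : T.Kˣ, (T.atLevel 1).unitsToBirat (T.BN 1) ⟨u₁, hu₁⟩ = T.constEmb 1 c →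
      ∀ N ∈ E, ∀ (a : h44.Ψ.functor.obj (T.AN N) ≅ T.AN N) (b : h44.Ψ.functor.obj (T.BN N) ≅ T.BN N) (w : Aut (T.BN N)),
        w ∈ (T.atLevel N).units (T.BN N) →
        a.inv ≫ h44.Ψ.functor.map (T.sCap N) ≫ b.hom = T.sCap N →
        a.inv ≫ h44.Ψ.functor.map (T.sCup N) ≫ b.hom = T.sCup N ≫ w.hom →
        a.inv ≫ h44.Ψ.functor.map (T.α (one_dvd_level N)) ≫ α₁.hom = T.α (one_dvd_level N) →
        b.inv ≫ h44.Ψ.functor.map (T.β (one_dvd_level N)) ≫ β₁.hom = T.β (one_dvd_level N) →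
          ∃ u ∈ (T.atLevel N).muTorsion (T.BN N) N, ∀ k : (T.atLevel N).PiYdd,
            T.sgpCup N ((T.atLevel N).rhoYdd k) * w ^ (2 * T.l) * (T.sgpCup N ((T.atLevel N).rhoYdd k))⁻¹ * (w ^ (2 * T.l))⁻¹ =
              T.sgpCup N ((T.atLevel N).rhoYdd k) * u * (T.sgpCup N ((T.atLevel N).rhoYdd k))⁻¹ * u⁻¹) :
    T.ThetaRootPreservedAll h44.Ψ := by
  -- Prop. 3.2 (iii) for the MLF `K'`, read on `T.K` (which IS `K'` along `hT`; `rw` on the small goal, not `subst`)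
  have hK : ∀ x : T.Kˣ, (∀ N : ℕ+, ∃ d : T.Kˣ, d ^ (N : ℕ) = x) → x = 1 := by
    rw [hT]
    exact MLFDivisible.units_eq_one_of_forall_exists_pow_eq p K'
  exact thetaRootPreservedAll_ofConnectedTemperoidYddFamily_final_v6
    𝒯 ιX h Q odd_l R K' hX₀ t c₀ hc₀ ht hinvc (hinvp_family_ofConnectedTemperoidYddTower h R) α β comm_sCap comm_sCup isIsometry_α degFr_α
    isIsometry_β degFr_β baseFrob_α h44 ψ hpull hii h3 h4b h8 h15a h15 D T hT hnd hgc cnst G ecn hP34 hYdd hF hαover hcharAN hdivA hP24 h58N hL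
    hK htorsfam

end DictionaryV6MLFK

end ThetaFrobenioidTower

end Literature.AnabelianGeometry.EtaleTheta

end
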